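import Summits.Ventures.HodgeRepro2.T5SU11LegendreTuran
import Summits.Ventures.HodgeRepro2.T5SU11GaussLegendreConvergence
import Summits.Ventures.HodgeRepro2.T5SU11LegendreAtZero

/-!
# Vieta's formulas for the zeros of the Legendre polynomials:
`Σ x_i = 0`, `Σ_{i<j} x_i x_j = −n(n − 1)/(2(2n − 1))`, `Σ x_i² = n(n − 1)/(2n − 1)`, `∏ x_i`

Legendre's equation in `ℝ[X]` (row 399, `legendre_ode_poly`) read off coefficient by coefficient gives the two-step
recursion **`(k + 2)(k + 1) a_{k+2} = (k(k + 1) − n(n + 1)) a_k`** for the coefficients `a_k` of `P_n`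
(`coeff_recursion`); at `k = n − 1` and `k = n − 2` it returns **`a_{n−1} = 0`** (`coeff_legPoly_pred`) and
**`a_{n−2} = −n(n − 1)/(2(2n − 1)) · a_n`** (`coeff_legPoly_sub_two`). Mathlib's Vieta
(`Polynomial.coeff_eq_esymm_roots_of_card`, fed with the `n` simple zeros of row 400) converts these into

  **`Σ_i x_i = 0`** (`sum_nodes`), **`Σ_{i<j} x_i x_j = −n(n − 1)/(2(2n − 1))`** (`esymm_two_nodes`),
  hence, by Newton's identity `(Σ x)² = Σ x² + 2 Σ_{i<j} x_i x_j` (`sq_sum_eq`), **`Σ_i x_i² = n(n − 1)/(2n − 1)`**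
  (`sum_sq_nodes`)

over the zeros `x_1, …, x_n` of `P_n` (the nodes of row 419), and the product of the zeros
**`∏ x_i = (−1)^n P_n(0)/lc_n`** (`prod_nodes`), `= (−1)^m C(2m, m) 4^{−m} / lc_{2m}` for `n = 2m` and `0` for `n` odd
(row 396). The mean square of the zeros `(1/n) Σ x_i² = (n − 1)/(2n − 1) → 1/2` (`mean_sq_nodes`,
`tendsto_mean_sq_nodes`): the zeros spread with the second moment `1/2` of the arcsine law. Nothing is claimed
about (N).

Blind lane: Mathlib + the HodgeRepro2 prefix only; no sorry; axioms ⊆ {propext, Classical.choice,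
Quot.sound}.
-/

namespace Summit.Ventures.HodgeRepro2.T5SU11LegendreVieta

open Polynomial Finset Set Filter Topology
open T5SU11SphericalLegendreAll T5SU11JacobiPhaseLawEven T5SU11JacobiLegendreLeading T5SU11LegendreIdentities
  T5SU11LegendreZeros T5SU11LegendreTuran T5SU11GaussLegendreConvergence T5SU11LegendreAtZero
  T5SU11LegendreHeine

/-! ### The coefficient recursion from Legendre's equation -/

/-- Legendre's equation in `ℝ[X]` with the scalars written as `C`:
`D²P_n − X²·D²P_n − C 2·(X·DP_n) + C(n(n + 1))·P_n = 0`. -/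
theorem legendre_ode_poly' (n : ℕ) :
    derivative (derivative (legPoly n)) - X ^ 2 * derivative (derivative (legPoly n))
      - C (2 : ℝ) * (X * derivative (legPoly n)) + C ((n : ℝ) * ((n : ℝ) + 1)) * legPoly n = 0 := by
  have h := legendre_ode_poly n
  have hC : C ((n : ℝ) * ((n : ℝ) + 1)) = (n : ℝ[X]) * ((n : ℝ[X]) + 1) := by
    simp only [map_mul, map_add, map_one, map_natCast]
  have h2 : C (2 : ℝ) = (2 : ℝ[X]) := by simp only [map_ofNat]
  rw [hC, h2]
  linear_combination h

/-- **The two-step coefficient recursion of Legendre's equation**: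
`(k + 2)(k + 1) a_{k+2} = (k(k + 1) − n(n + 1)) a_k` for the coefficients `a_k = coeff (legPoly n) k`. -/
theorem coeff_recursion (n k : ℕ) :
    ((k : ℝ) + 2) * ((k : ℝ) + 1) * (legPoly n).coeff (k + 2)
      = ((k : ℝ) * ((k : ℝ) + 1) - (n : ℝ) * ((n : ℝ) + 1)) * (legPoly n).coeff k := by
  have h := congrArg (fun p : ℝ[X] => p.coeff k) (legendre_ode_poly' n)
  simp only [coeff_sub, coeff_add, coeff_C_mul, coeff_derivative, coeff_zero] at h
  rcases k with _ | _ | j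
  · simp only [coeff_X_pow_mul', coeff_X_mul_zero, Nat.cast_zero] at h
    norm_num at h
    linear_combination h
  · simp only [coeff_X_pow_mul', coeff_X_mul, coeff_derivative, Nat.cast_zero] at h
    norm_num at h
    linear_combination h
  · rw [coeff_X_pow_mul, coeff_X_mul, coeff_derivative, coeff_derivative] at h
    push_cast at h ⊢
    linear_combination h

/-- **`a_{n−1} = 0`**: the coefficient of `X^{n−1}` in `P_n` vanishes (`n ≥ 1`; the parity of `P_n`). -/
theorem coeff_legPoly_pred {n : ℕ} (hn : 1 ≤ n) : (legPoly n).coeff (n - 1) = 0 := by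
  obtain ⟨m, rfl⟩ : ∃ m, n = m + 1 := ⟨n - 1, by omega⟩
  have h := coeff_recursion (m + 1) m
  have h0 : (legPoly (m + 1)).coeff (m + 2) = 0 :=
    coeff_eq_zero_of_natDegree_lt (by rw [natDegree_legPoly]; omega)
  rw [h0, mul_zero] at h
  simp only [Nat.add_sub_cancel]
  push_cast at h
  have hne : (m : ℝ) * ((m : ℝ) + 1) - ((m : ℝ) + 1) * ((m : ℝ) + 1 + 1) ≠ 0 := by
    have : (m : ℝ) * ((m : ℝ) + 1) - ((m : ℝ) + 1) * ((m : ℝ) + 1 + 1) = -2 * ((m : ℝ) + 1) := by ring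
    rw [this]
    have : (0 : ℝ) < (m : ℝ) + 1 := by positivity
    linarith
  rcases mul_eq_zero.mp h.symm with h1 | h1
  · exact absurd h1 hne
  · exact h1

/-- **`a_{n−2} = −n(n − 1)/(2(2n − 1)) · lc_n`** (`n ≥ 2`), `lc_n = legLead n` the leading coefficient. -/
theorem coeff_legPoly_sub_two {n : ℕ} (hn : 2 ≤ n) :
    (legPoly n).coeff (n - 2) = -((n : ℝ) * ((n : ℝ) - 1) / (2 * (2 * (n : ℝ) - 1))) * legLead n := by
  obtain ⟨m, rfl⟩ : ∃ m, n = m + 2 := ⟨n - 2, by omega⟩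
  have h := coeff_recursion (m + 2) m
  rw [coeff_legPoly_self] at h
  simp only [Nat.add_sub_cancel]
  push_cast at h ⊢
  have hne : (2 : ℝ) * (2 * ((m : ℝ) + 2) - 1) ≠ 0 := by
    have : (2 : ℝ) * (2 * ((m : ℝ) + 2) - 1) = 4 * (m : ℝ) + 6 := by ring
    rw [this]; positivity
  have e : -(((m : ℝ) + 2) * ((m : ℝ) + 2 - 1) / (2 * (2 * ((m : ℝ) + 2) - 1))) * legLead (m + 2)
      = -(((m : ℝ) + 2) * ((m : ℝ) + 2 - 1) * legLead (m + 2)) / (2 * (2 * ((m : ℝ) + 2) - 1)) := by ring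
  rw [e, eq_div_iff hne]
  linear_combination h

/-! ### Vieta: the power sums and the product of the zeros -/

/-- The multiset of roots of `P_n` is the multiset of the nodes (row 400: `n` simple zeros). -/
theorem roots_eq_nodes_val (n : ℕ) : (legPoly n).roots = (nodes n).val := by
  rw [nodes, Multiset.toFinset_val, Multiset.dedup_eq_self.mpr (card_roots_legPoly n).2]

/-- `card (roots P_n) = natDegree P_n`: `P_n` splits over `ℝ` (row 400). -/
theorem card_roots_eq_natDegree (n : ℕ) : Multiset.card (legPoly n).roots = (legPoly n).natDegree := by
  rw [(card_roots_legPoly n).1, natDegree_legPoly]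

/-- The elementary symmetric functions of the zeros of `P_n` as sums over the `k`-subsets of the nodes. -/
theorem esymm_roots (n k : ℕ) :
    (legPoly n).roots.esymm k = ∑ t ∈ (nodes n).powersetCard k, ∏ x ∈ t, x := by
  rw [roots_eq_nodes_val]
  have := Finset.esymm_map_val (fun x : ℝ => x) (nodes n) k
  simpa only [Multiset.map_id'] using this

/-- **Vieta for `P_n`**: `a_k = lc_n · (−1)^{n−k} · e_{n−k}(x_1, …, x_n)`. -/
theorem coeff_legPoly_eq_esymm (n : ℕ) {k : ℕ} (hk : k ≤ n) :
    (legPoly n).coeff k = legLead n * (-1) ^ (n - k) * ∑ t ∈ (nodes n).powersetCard (n - k), ∏ x ∈ t, x := by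
  have h := Polynomial.coeff_eq_esymm_roots_of_card (card_roots_eq_natDegree n) (k := k)
    (by rw [natDegree_legPoly]; exact hk)
  rw [natDegree_legPoly, leadingCoeff_legPoly, esymm_roots] at h
  exact h

/-- **`Σ_i x_i = 0`**: the zeros of `P_n` have sum zero (`n ≥ 1`). -/
theorem sum_nodes {n : ℕ} (hn : 1 ≤ n) : ∑ x ∈ nodes n, x = 0 := by
  have h := coeff_legPoly_eq_esymm n (k := n - 1) (by omega)
  have h1 : n - (n - 1) = 1 := by omega
  rw [coeff_legPoly_pred hn, h1, pow_one, Finset.powersetCard_one, Finset.sum_map] at h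
  simp only [Function.Embedding.coeFn_mk, Finset.prod_singleton] at h
  have hL := (legLead_pos n).ne'
  rcases mul_eq_zero.mp h.symm with h2 | h2
  · exact absurd h2 (mul_ne_zero hL (by norm_num))
  · exact h2

/-- **`Σ_{i<j} x_i x_j = −n(n − 1)/(2(2n − 1))`**: the second elementary symmetric function of the zeros (`n ≥ 2`). -/
theorem esymm_two_nodes {n : ℕ} (hn : 2 ≤ n) :
    ∑ t ∈ (nodes n).powersetCard 2, ∏ x ∈ t, x = -((n : ℝ) * ((n : ℝ) - 1) / (2 * (2 * (n : ℝ) - 1))) := by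
  have h := coeff_legPoly_eq_esymm n (k := n - 2) (by omega)
  have h1 : n - (n - 2) = 2 := by omega
  rw [coeff_legPoly_sub_two hn, h1] at h
  norm_num at h
  have hL := (legLead_pos n).ne'
  refine mul_left_cancel₀ hL ?_
  linear_combination -h

/-- **Newton's identity, `k = 2`, for a finite set of reals**: `(Σ x)² = Σ x² + 2 Σ_{i<j} x_i x_j`. -/
theorem sq_sum_eq (s : Finset ℝ) :
    (∑ x ∈ s, x) ^ 2 = ∑ x ∈ s, x ^ 2 + 2 * ∑ t ∈ s.powersetCard 2, ∏ x ∈ t, x := by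
  classical
  induction s using Finset.induction_on with
  | empty => rw [Finset.powersetCard_eq_empty.mpr (by simp)]; simp
  | insert a s ha ih =>
    have hp := Finset.powersetCard_succ_insert ha 1
    have hdisj : Disjoint (s.powersetCard 2) ((s.powersetCard 1).image (insert a)) := by
      rw [Finset.disjoint_left]
      intro t ht1 ht2
      obtain ⟨u, -, rfl⟩ := Finset.mem_image.mp ht2
      exact ha ((Finset.mem_powersetCard.mp ht1).1 (Finset.mem_insert_self a u))
    have hinj : Set.InjOn (insert a) (s.powersetCard 1 : Set (Finset ℝ)) := by
      intro u hu v hv huv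
      have hau : a ∉ u := fun h => ha ((Finset.mem_powersetCard.mp hu).1 h)
      have hav : a ∉ v := fun h => ha ((Finset.mem_powersetCard.mp hv).1 h)
      rw [← Finset.erase_insert hau, ← Finset.erase_insert hav, huv]
    have himage : ∑ t ∈ (s.powersetCard 1).image (insert a), ∏ x ∈ t, x = a * ∑ x ∈ s, x := by
      rw [Finset.sum_image hinj, Finset.powersetCard_one, Finset.sum_map, Finset.mul_sum]
      refine Finset.sum_congr rfl fun x hx => ?_
      simp only [Function.Embedding.coeFn_mk]
      have hax : a ∉ ({x} : Finset ℝ) := fun h => ha (Finset.mem_singleton.mp h ▸ hx)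
      rw [Finset.prod_insert hax, Finset.prod_singleton]
    rw [Finset.sum_insert ha, Finset.sum_insert ha, hp, Finset.sum_union hdisj, himage]
    linear_combination ih

/-- **`Σ_i x_i² = n(n − 1)/(2n − 1)`**: the sum of the squares of the zeros of `P_n` (`n ≥ 1`). -/
theorem sum_sq_nodes {n : ℕ} (hn : 1 ≤ n) : ∑ x ∈ nodes n, x ^ 2 = (n : ℝ) * ((n : ℝ) - 1) / (2 * (n : ℝ) - 1) := by
  rcases Nat.lt_or_ge n 2 with h2 | h2
  · -- `n = 1`: the only zero is `0`
    have h1 : n = 1 := by omega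
    subst h1
    have := sq_sum_eq (nodes 1)
    rw [sum_nodes le_rfl] at this
    have hc : (nodes 1).powersetCard 2 = ∅ := by
      apply Finset.powersetCard_eq_empty.mpr
      rw [card_nodes]; norm_num
    rw [hc, Finset.sum_empty, mul_zero, add_zero] at this
    rw [← this]; norm_num
  · have h := sq_sum_eq (nodes n)
    rw [sum_nodes (by omega), esymm_two_nodes h2] at h
    have hne : (2 : ℝ) * (n : ℝ) - 1 ≠ 0 := by
      have : (2 : ℝ) ≤ (n : ℝ) := by exact_mod_cast h2
      linarith
    have e : (2 : ℝ) * -((n : ℝ) * ((n : ℝ) - 1) / (2 * (2 * (n : ℝ) - 1)))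
        = -((n : ℝ) * ((n : ℝ) - 1) / (2 * (n : ℝ) - 1)) := by
      field_simp
    rw [e] at h
    linear_combination (-1 : ℝ) * h

/-- **The product of the zeros**: `∏_i x_i = (−1)^n P_n(0)/lc_n`. -/
theorem prod_nodes (n : ℕ) : ∏ x ∈ nodes n, x = (-1) ^ n * legP n 0 / legLead n := by
  have h := coeff_legPoly_eq_esymm n (k := 0) (Nat.zero_le n)
  have hs : (nodes n).powersetCard n = {nodes n} := by
    have := Finset.powersetCard_self (nodes n)
    rwa [card_nodes] at this
  rw [Nat.sub_zero, hs, Finset.sum_singleton, coeff_zero_eq_eval_zero, ← legP_eq_eval] at h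
  have hL := (legLead_pos n).ne'
  rw [eq_div_iff hL, h]
  have : ((-1 : ℝ) ^ n) ^ 2 = 1 := by rw [← pow_mul, mul_comm, pow_mul]; simp
  linear_combination (-(legLead n * ∏ x ∈ nodes n, x)) * this

/-- The product of the zeros of `P_{2m+1}` is `0` (`0` is a zero: row 396). -/
theorem prod_nodes_odd (m : ℕ) : ∏ x ∈ nodes (2 * m + 1), x = 0 := by
  rw [prod_nodes, legP_zero_odd, mul_zero, zero_div]

/-- The product of the zeros of `P_{2m}` is `(−1)^m C(2m, m) 4^{−m} / lc_{2m}` (row 396's `P_{2m}(0)`). -/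
theorem prod_nodes_even (m : ℕ) : ∏ x ∈ nodes (2 * m), x = (-1) ^ m * binomHalf m / legLead (2 * m) := by
  rw [prod_nodes, legP_zero_even, pow_mul]
  norm_num

/-! ### The mean square of the zeros -/

/-- **The mean square of the zeros**: `(1/n) Σ_i x_i² = (n − 1)/(2n − 1)` (`n ≥ 1`). -/
theorem mean_sq_nodes {n : ℕ} (hn : 1 ≤ n) :
    (∑ x ∈ nodes n, x ^ 2) / n = ((n : ℝ) - 1) / (2 * (n : ℝ) - 1) := by
  rw [sum_sq_nodes hn]
  have hn' : (n : ℝ) ≠ 0 := by exact_mod_cast (by omega : n ≠ 0)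
  have hne : (2 : ℝ) * (n : ℝ) - 1 ≠ 0 := by
    have : (1 : ℝ) ≤ (n : ℝ) := by exact_mod_cast hn
    linarith
  field_simp

/-- **The mean square of the zeros tends to `1/2`** — the second moment of the arcsine law on `[−1, 1]`. -/
theorem tendsto_mean_sq_nodes :
    Tendsto (fun n : ℕ => (∑ x ∈ nodes n, x ^ 2) / n) atTop (𝓝 (1 / 2)) := by
  have h : Tendsto (fun n : ℕ => ((n : ℝ) - 1) / (2 * (n : ℝ) - 1)) atTop (𝓝 (1 / 2)) := by
    have e : ∀ n : ℕ, 1 ≤ n → ((n : ℝ) - 1) / (2 * (n : ℝ) - 1) = (1 - 1 / (n : ℝ)) / (2 - 1 / (n : ℝ)) := by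
      intro n hn
      have hn' : (n : ℝ) ≠ 0 := by exact_mod_cast (by omega : n ≠ 0)
      field_simp
    have h1 : Tendsto (fun n : ℕ => (1 - 1 / (n : ℝ)) / (2 - 1 / (n : ℝ))) atTop (𝓝 ((1 - 0) / (2 - 0))) :=
      ((tendsto_const_nhds.sub tendsto_one_div_atTop_nhds_zero_nat).div
        (tendsto_const_nhds.sub tendsto_one_div_atTop_nhds_zero_nat) (by norm_num))
    rw [show ((1 : ℝ) - 0) / (2 - 0) = 1 / 2 by norm_num] at h1
    refine h1.congr' ?_
    filter_upwards [eventually_ge_atTop 1] with n hn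
    exact (e n hn).symm
  refine h.congr' ?_
  filter_upwards [eventually_ge_atTop 1] with n hn
  exact (mean_sq_nodes hn).symm

end Summit.Ventures.HodgeRepro2.T5SU11LegendreVieta
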